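import Summits.CriticalPhenomena.PercolationContinuityZ3.Theorems.PercNearOneGluingNoHeavyQuantFarBundleStep
import Summits.CriticalPhenomena.PercolationContinuityZ3.Theorems.PercNearOneGluingNoHeavyQuantFarLayerOneForest
import Summits.CriticalPhenomena.PercolationContinuityZ3.Theorems.PercNearOneGluingNoHeavyQuantFarLayerOneRing
import Summits.CriticalPhenomena.PercolationContinuityZ3.Theorems.PercNearOneGluingNoHeavyQuantFarLayerOneObserver
import Summits.CriticalPhenomena.PercolationContinuityZ3.Theorems.PercNearOneGluingNoHeavyQuantFarSupportReductions
import HarnessLib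

/-!
# QUANT lane R8, front "FAR beyond trees" — LAYER ONE OF FAR ON EVERY UNICYCLIC SUPPORT WITH THE OBSERVER ON THE CYCLE, from `SunFAR`

builds on p205010 (kernel theorem, internal audit signed; external expert review pending)

Support file (`--supports stmt-CriticalPhenomena-4575`), seat `prim-quant-p1` (gen 18); memo
`run/shared/lean/prim/quant/prim-quant-p1-g18/FOR-LEAD-UNICYCLIC-TREES.md` §3 (Theorem A), `FOR-PROVERS-FLATTENING-FC.md` (F-C).
Standard axioms; no sorries; no definitions (the presentation `PForest` is in `…QuantFarLayerOneForest`).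

**Presentation.**  `PForest L cyc idx T par dep w`: an injective cycle `c_i = cyc i` (`i < L`, `L ≥ 3`, `idx` an index map with `idx (c_i) = i`),
a finset `T` of tree vertices off the cycle with a parent map `par` (parent in `T` or on the cycle) and a ranking `dep` (`dep (par v) < dep v` when
`par v ∈ T`), and `w` supported on the cycle pairs `cycE` and the tree pairs `s(v, par v)`, `v ∈ T`.  Every finite weighted graph whose support is
unicyclic, with the observer `c_0` on the cycle and the relays in `T` or on the cycle, is of this form (pendant forests on a cycle).

* `Quant.Bundle.farp_one_of_pforest` — **FAR at layer one** (`TwoCopy.FARp w A (cyc 0) 1`: `2 < Σ_{a∈A} P(c_0 ↔ a)` and `P(c_0 ↮ a) ≤ t` on `A` imply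
  `P(#{a ∈ A : c_0 ↔ a} ≤ 1) ≤ t`) for every such presentation and every relay set `A ⊆ T ∪ cycle`, GIVEN `HairyCycle.SunFAR |A| 1`;
  `layerOne_of_pforest_of_sunFAR` (from `SunFAR K 1` for all `K ≥ 2`) (the UNCONDITIONAL `|A| ≤ 7` corollary, by the
  computational sun certificates, is `…QuantFarLayerOneUnicyclicLeSeven`).
  PROOF = the flattening algorithm of the memo (strong induction on `Σ_{v∈T} (dep v + 1)`): prune a non-relay leaf (`TwoCopy.farp_iff_of_pendant`),
  exit at a relay leaf under a relay (`Bundle.real_card_le_one_le_of_pendant_relay`), DETACH the heaviest leaf of a deepest bundle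
  (`Bundle.real_card_le_one_le_of_wDet`, marginals by `Bundle.real_openConn_wDet_eq`), and at the end (all tree vertices are relay leaves hanging
  at cycle vertices) the ring bridge `HairyCycle.farRelayRow_ring_of_sunFAR_att`.
The observer OFF the cycle reduces to this by `Bundle.layerOne_of_pendant_observer` / two-block (`Quant.farRelayRow_layerOne_of_twoBlocks`); `o ∈ A` is
`Bundle.layerOne_of_observer_mem` — assembly of those wrappers is left to the route-vocabulary file.
[cite: KozmaNitzan2024, Conjecture 3 (p. 15)] (the row); [cite: Grimmett1999, §1.3 p. 10]; [this work].
-/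

noncomputable section

namespace Summit.CriticalPhenomena.PercolationContinuityZ3.Theorems

namespace Quant

namespace Bundle

open Finset MeasureTheory Set
open Literature.Probability.LatticeModels
open Literature.Probability.Percolation
open Summit.CriticalPhenomena.PercolationContinuityZ3.Theorems.HairyCycle (cycE SunFAR)
open scoped Classical

variable {n : ℕ}

/-! ## The flattening induction -/

section Main

variable {L : ℕ} {cyc : ℕ → Fin n} {idx : Fin n → ℕ}

/-- **FAR at layer one on every pendant forest on a cycle, given `SunFAR K 1` for all `K ≥ 2`** (observer `c_0`, relays in the trees or on the
cycle).  Strong induction on `Σ_{v∈T} (dep v + 1)` along the flattening algorithm (memo Theorem A). [this work] -/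
theorem farp_one_of_pforest (A : Finset (Fin n)) (hS : SunFAR A.card 1) :
    ∀ (m : ℕ) (T : Finset (Fin n)) (par : Fin n → Fin n) (dep : Fin n → ℕ) (w : Sym2 (Fin n) → unitInterval),
      PForest L cyc idx T par dep w → ∑ v ∈ T, (dep v + 1) ≤ m → (∀ a ∈ A, a ∈ T ∨ ∃ i, i < L ∧ a = cyc i) → cyc 0 ∉ A →
      TwoCopy.FARp w A (cyc 0) 1 := by
  intro m
  induction m using Nat.strong_induction_on with
  | _ m IH =>
  intro T par dep w P hm hA hoA hEN t hcut
  have hmeas : ∀ U : Set (BondConfig (Fin n)), MeasurableSet U := fun U => (Set.toFinite U).measurableSet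
  have hL0 : 0 < L := by have := P.hL; omega
  have hoT : cyc 0 ∉ T := P.cyc_notMem 0 hL0
  -- (0) a relay with a vanishing marginal forces `t ≥ 1`
  by_cases hzero : ∃ a ∈ A, (prodBernoulli w).real (openConn (cyc 0) a) = 0
  · obtain ⟨a, ha, h0⟩ := hzero
    have := hcut a ha
    rw [probReal_compl_eq_one_sub (hmeas _), h0] at this
    exact measureReal_le_one.trans (by linarith)
  push Not at hzero
  -- (1) PRUNE: a non-relay tree leaf
  by_cases hprune : ∃ c ∈ T, c ∉ A ∧ ∀ d ∈ T, par d ≠ c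
  · obtain ⟨c, hcT, hcA, hleaf⟩ := hprune
    have hpend := P.pendant_of_leaf hcT hleaf
    have hoc : cyc 0 ≠ c := fun h => hoT (h ▸ hcT)
    have P' : PForest L cyc idx (T.erase c) par dep (Function.update w s(c, par c) 0) := by
      refine ⟨P.hL, P.hcyc, P.hidx, fun i hi h => P.cyc_notMem i hi (mem_of_mem_erase h), ?_, ?_, ?_⟩
      · intro v hv
        have hvT := mem_of_mem_erase hv
        rcases P.par_mem v hvT with hp | hp
        · left; exact mem_erase.2 ⟨fun h => hleaf v hvT h, hp⟩
        · exact Or.inr hp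
      · intro v hv hp; exact P.dep_lt v (mem_of_mem_erase hv) (mem_of_mem_erase hp)
      · intro x y hxy hw
        have hne : s(x, y) ≠ s(c, par c) := by
          intro h; rw [h, Function.update_self] at hw; exact hw rfl
        rw [Function.update_of_ne hne] at hw
        rcases P.supp x y hxy hw with h | ⟨hx, h⟩ | ⟨hy, h⟩
        · exact Or.inl h
        · right; left
          refine ⟨mem_erase.2 ⟨fun hxc => hne ?_, hx⟩, h⟩
          subst hxc; rw [h]
        · right; right
          refine ⟨mem_erase.2 ⟨fun hyc => hne ?_, hy⟩, h⟩
          subst hyc; rw [h, Sym2.eq_swap]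
    have hm' : ∑ v ∈ T.erase c, (dep v + 1) < m := by
      have := sum_erase_add T (fun v => dep v + 1) hcT
      omega
    have hA' : ∀ a ∈ A, a ∈ T.erase c ∨ ∃ i, i < L ∧ a = cyc i := by
      intro a ha
      rcases hA a ha with h | h
      · left; exact mem_erase.2 ⟨fun hac => hcA (hac ▸ ha), h⟩
      · exact Or.inr h
    have key := IH _ hm' (T.erase c) par dep _ P' le_rfl hA' hoA
    exact ((TwoCopy.farp_iff_of_pendant w A (cyc 0) 1 (P.par_ne hcT) hcA hoc hpend).2 key) hEN t hcut
  push Not at hprune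
  -- every tree leaf is a relay
  have hleafA : ∀ c ∈ T, (∀ d ∈ T, par d ≠ c) → c ∈ A := by
    intro c hc hleaf; by_contra hcA; exact absurd hleaf (by simpa using hprune c hc hcA)
  -- internal tree vertices
  set Tin := T.filter fun v => ∃ c ∈ T, par c = v with hTin
  by_cases hin : Tin.Nonempty
  · -- (B) a deepest internal vertex `u`; its children are relay leaves
    obtain ⟨u, huin, humax⟩ := Tin.exists_max_image dep hin
    have huT : u ∈ T := (mem_filter.1 huin).1
    set C := T.filter fun c => par c = u with hC
    have hCT : ∀ c ∈ C, c ∈ T := fun c hc => (mem_filter.1 hc).1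
    have hCpar : ∀ c ∈ C, par c = u := fun c hc => (mem_filter.1 hc).2
    have hCne : C.Nonempty := by
      obtain ⟨c, hc, hpc⟩ := (mem_filter.1 huin).2
      exact ⟨c, mem_filter.2 ⟨hc, hpc⟩⟩
    have hCleaf : ∀ c ∈ C, ∀ d ∈ T, par d ≠ c := by
      intro c hc d hd hdc
      have hcT : c ∈ T := hCT c hc
      have hcin : c ∈ Tin := mem_filter.2 ⟨hcT, d, hd, hdc⟩
      have h1 := humax c hcin
      have h2 := P.dep_lt c hcT (by rw [hCpar c hc]; exact huT)
      rw [hCpar c hc] at h2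
      omega
    have hCA : ∀ c ∈ C, c ∈ A := fun c hc => hleafA c (hCT c hc) (hCleaf c hc)
    obtain ⟨c₀, hc₀⟩ := hCne
    by_cases huA : u ∈ A
    · -- (B2) EXIT: a relay leaf under a relay
      have hcT := hCT c₀ hc₀
      exact real_card_le_one_le_of_pendant_relay w A (hCA c₀ hc₀) huA
        (fun h => P.par_ne hcT ((hCpar c₀ hc₀).trans h.symm)) (fun h => hoT (by rw [h]; exact hcT))
        (fun x hx hxu => P.pendant_of_leaf hcT (hCleaf c₀ hc₀) x hx (by rw [hCpar c₀ hc₀]; exact hxu)) t hcut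
    -- (B3) DETACH the heaviest leaf of the bundle at `u`
    obtain ⟨ℓ₁, hℓ₁C, hmax⟩ := C.exists_max_image (fun c => (w s(u, c) : ℝ)) ⟨c₀, hc₀⟩
    have hℓ₁T : ℓ₁ ∈ T := hCT ℓ₁ hℓ₁C
    have hpu : par u ≠ u := P.par_ne huT
    have hpC : par u ∉ C := by
      intro hpc
      have h1 := P.dep_lt u huT (hCT _ hpc)
      have h2 := P.dep_lt (par u) (hCT _ hpc) (by rw [hCpar _ hpc]; exact huT)
      rw [hCpar _ hpc] at h2; omega
    have HP : IsPocket (cyc 0) (par u) u ℓ₁ C :=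
      ⟨hpu, hpC, fun h => hoT (h ▸ huT), fun h => hoT (hCT _ h), fun h => hpu (hCpar u h), hℓ₁C⟩
    have hmemT_of_Z : ∀ x, x ∈ insert u C → x ∈ T := by
      intro x hx
      rcases mem_insert.1 hx with hxu | hxC
      · rw [hxu]; exact huT
      · exact hCT x hxC
    -- support hypotheses of the bundle step
    have hw0 : ∀ x y : Fin n, x ≠ y → (x ∈ insert u C ∨ y ∈ insert u C) → ¬ Allowed (par u) u ℓ₁ C s(x, y) →
        (w s(x, y) : ℝ) = 0 := by
      intro x y hxy hZ hna
      by_contra hw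
      have hw' : w s(x, y) ≠ 0 := fun h => hw (by rw [h]; rfl)
      apply hna
      rcases P.supp x y hxy hw' with ⟨i, hi, he⟩ | ⟨hx, h⟩ | ⟨hy, h⟩
      · exfalso
        rcases hZ with hz | hz
        · exact P.not_mem_cycE (hmemT_of_Z x hz) hi (he ▸ Sym2.mem_mk_left x y)
        · exact P.not_mem_cycE (hmemT_of_Z y hz) hi (he ▸ Sym2.mem_mk_right x y)
      · -- `x ∈ T`, `y = par x`
        rcases hZ with hz | hz
        · rcases mem_insert.1 hz with hxu | hxC
          · left; rw [hxu, h, hxu, Sym2.eq_swap]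
          · right; right; exact ⟨x, hxC, by rw [h, hCpar x hxC, Sym2.eq_swap]⟩
        · rcases mem_insert.1 hz with hyu | hyC
          · have hxC : x ∈ C := mem_filter.2 ⟨hx, by rw [← hyu]; exact h.symm⟩
            right; right; exact ⟨x, hxC, by rw [h, hCpar x hxC, Sym2.eq_swap]⟩
          · exact absurd h.symm (hCleaf y hyC x hx)
      · -- `y ∈ T`, `x = par y`
        rcases hZ with hz | hz
        · rcases mem_insert.1 hz with hxu | hxC
          · have hyC : y ∈ C := mem_filter.2 ⟨hy, by rw [← hxu]; exact h.symm⟩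
            right; right; exact ⟨y, hyC, by rw [h, hCpar y hyC]⟩
          · exact absurd h.symm (hCleaf x hxC y hy)
        · rcases mem_insert.1 hz with hyu | hyC
          · left; rw [hyu, h, hyu]
          · right; right; exact ⟨y, hyC, by rw [h, hCpar y hyC]⟩
    have hb : (w s(par u, ℓ₁) : ℝ) = 0 := by
      by_contra hw
      have hw' : w s(par u, ℓ₁) ≠ 0 := fun h => hw (by rw [h]; rfl)
      have hpl : par u ≠ ℓ₁ := fun h => hpC (h ▸ hℓ₁C)
      rcases P.supp (par u) ℓ₁ hpl hw' with ⟨i, hi, he⟩ | ⟨hx, h⟩ | ⟨-, h⟩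
      · exact P.not_mem_cycE hℓ₁T hi (he ▸ Sym2.mem_mk_right (par u) ℓ₁)
      · exact hCleaf ℓ₁ hℓ₁C (par u) hx h.symm
      · exact hpu (h.trans (hCpar ℓ₁ hℓ₁C))
    have hp1 : 0 < (w s(u, ℓ₁) : ℝ) := by
      rcases (w s(u, ℓ₁)).2.1.lt_or_eq with h | h
      · exact h
      · exfalso
        refine hzero ℓ₁ (hCA ℓ₁ hℓ₁C) (real_openConn_eq_zero_of_isolated w (fun h' => hoT (h' ▸ hℓ₁T)) fun x hx => ?_)
        by_cases hxu : x = u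
        · subst hxu
          have : w s(ℓ₁, x) = w s(x, ℓ₁) := by rw [Sym2.eq_swap]
          rw [this]; exact Subtype.ext h.symm
        · exact P.pendant_of_leaf hℓ₁T (hCleaf ℓ₁ hℓ₁C) x hx (by rw [hCpar ℓ₁ hℓ₁C]; exact hxu)
    have hmax' : ∀ ℓ ∈ C, (w s(u, ℓ) : ℝ) ≤ w s(u, ℓ₁) := hmax
    refine real_card_le_one_le_of_wDet HP w hw0 hCA huA hb hp1 hmax' t hcut ?_
    -- the DETACHED presentation
    set par' := Function.update par ℓ₁ (par u) with hpar'
    set dep' := Function.update dep ℓ₁ (dep u) with hdep'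
    have hℓ₁u : par ℓ₁ = u := hCpar ℓ₁ hℓ₁C
    have hul : dep u < dep ℓ₁ := by
      have := P.dep_lt ℓ₁ hℓ₁T (by rw [hℓ₁u]; exact huT); rwa [hℓ₁u] at this
    have hpl : par u ≠ ℓ₁ := fun h => hpC (h ▸ hℓ₁C)
    have P' : PForest L cyc idx T par' dep' (wDet (par u) u ℓ₁ w) := by
      refine ⟨P.hL, P.hcyc, P.hidx, P.cyc_notMem, ?_, ?_, ?_⟩
      · intro v hv
        by_cases hvl : v = ℓ₁
        · subst hvl; rw [hpar', Function.update_self]; exact P.par_mem u huT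
        · rw [hpar', Function.update_of_ne hvl]; exact P.par_mem v hv
      · intro v hv hp
        by_cases hvl : v = ℓ₁
        · subst hvl
          rw [hpar', Function.update_self] at hp ⊢
          rw [hdep', Function.update_self, Function.update_of_ne hpl]
          exact P.dep_lt u huT hp
        · rw [hpar', Function.update_of_ne hvl] at hp ⊢
          have hpvl : par v ≠ ℓ₁ := hCleaf ℓ₁ hℓ₁C v hv
          rw [hdep', Function.update_of_ne hvl, Function.update_of_ne hpvl]
          exact P.dep_lt v hv hp
      · intro x y hxy hw
        by_cases h1 : s(x, y) = s(par u, ℓ₁)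
        · rcases Sym2.eq_iff.1 h1 with ⟨hx, hy⟩ | ⟨hx, hy⟩
          · right; right; refine ⟨hy ▸ hℓ₁T, ?_⟩; rw [hy, hpar', Function.update_self]; exact hx
          · right; left; refine ⟨hx ▸ hℓ₁T, ?_⟩; rw [hx, hpar', Function.update_self]; exact hy
        by_cases h2 : s(x, y) = s(u, ℓ₁)
        · exfalso; apply hw; rw [h2]; exact Subtype.ext (wDet_ul1 HP w)
        rw [wDet_of_ne w h2 h1] at hw
        rcases P.supp x y hxy hw with h | ⟨hx, h⟩ | ⟨hy, h⟩
        · exact Or.inl h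
        · right; left
          have hxl : x ≠ ℓ₁ := by
            intro hxl; apply h2; rw [hxl, h, hxl, hℓ₁u, Sym2.eq_swap]
          refine ⟨hx, ?_⟩; rw [hpar', Function.update_of_ne hxl]; exact h
        · right; right
          have hyl : y ≠ ℓ₁ := by
            intro hyl; apply h2; rw [hyl, h, hyl, hℓ₁u]
          refine ⟨hy, ?_⟩; rw [hpar', Function.update_of_ne hyl]; exact h
    have hm' : ∑ v ∈ T, (dep' v + 1) < m := by
      have e1 := sum_erase_add T (fun v => dep' v + 1) hℓ₁T
      have e2 := sum_erase_add T (fun v => dep v + 1) hℓ₁T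
      have e3 : ∑ v ∈ T.erase ℓ₁, (dep' v + 1) = ∑ v ∈ T.erase ℓ₁, (dep v + 1) :=
        sum_congr rfl fun v hv => by rw [hdep', Function.update_of_ne (ne_of_mem_erase hv)]
      have e4 : dep' ℓ₁ = dep u := by rw [hdep', Function.update_self]
      simp only [e4] at e1
      omega
    have key := IH _ hm' T par' dep' _ P' le_rfl hA hoA
    have hmarg : ∀ a ∈ A, (prodBernoulli (wDet (par u) u ℓ₁ w)).real (openConn (cyc 0) a) =
        (prodBernoulli w).real (openConn (cyc 0) a) := fun a ha => real_openConn_wDet_eq HP w hw0 huA hb ha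
    refine key ?_ t ?_
    · rw [sum_congr rfl hmarg]; exact hEN
    · intro a ha
      rw [probReal_compl_eq_one_sub (hmeas _), hmarg a ha, ← probReal_compl_eq_one_sub (hmeas _)]
      exact hcut a ha
  · -- (A) no internal vertex: every tree vertex is a relay leaf hanging at a cycle vertex
    rw [Finset.not_nonempty_iff_eq_empty] at hin
    have hnoint : ∀ v ∈ T, ∀ d ∈ T, par d ≠ v := by
      intro v hv d hd hdv
      have : v ∈ Tin := mem_filter.2 ⟨hv, d, hd, hdv⟩
      rw [hin] at this; exact absurd this (Finset.notMem_empty v)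
    have hTA : ∀ v ∈ T, v ∈ A := fun v hv => hleafA v hv (hnoint v hv)
    have hparcyc : ∀ v ∈ T, ∃ i, i < L ∧ par v = cyc i := by
      intro v hv
      rcases P.par_mem v hv with hp | hp
      · exact absurd rfl (hnoint (par v) hp v hv)
      · exact hp
    by_cases hrel : ∃ v ∈ T, par v ∈ A
    · -- EXIT: a hair at a cycle relay
      obtain ⟨v, hv, hpv⟩ := hrel
      exact real_card_le_one_le_of_pendant_relay w A (hTA v hv) hpv (P.par_ne hv).symm (fun h => hoT (by rw [h]; exact hv))
        (P.pendant_of_leaf hv (hnoint v hv)) t hcut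
    push Not at hrel
    -- the RING: attach `a ∈ T` at `idx (par a)`, a cycle relay at its own index
    have hK : 2 ≤ A.card := by
      have hle : ∑ a ∈ A, (prodBernoulli w).real (openConn (cyc 0) a) ≤ ∑ _a ∈ A, (1 : ℝ) :=
        sum_le_sum fun a _ => measureReal_le_one
      rw [sum_const, nsmul_eq_mul, mul_one] at hle
      have : (2 : ℝ) < A.card := by push_cast at hEN; linarith
      exact_mod_cast this.le
    set att : Fin n → ℕ := fun a => if a ∈ T then idx (par a) else idx a with hatt_def
    have hatt : ∀ a ∈ A, att a < L := by
      intro a ha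
      rcases hA a ha with haT | ⟨i, hi, hai⟩
      · obtain ⟨i, hi, hpi⟩ := hparcyc a haT
        simp only [hatt_def, haT, if_true, hpi, P.hidx i hi]; exact hi
      · subst hai
        simp only [hatt_def, P.cyc_notMem i hi, if_false, P.hidx i hi]; exact hi
    have hcycrel : ∀ a ∈ A, ∀ i, i < L → a = cyc i → att a = i := by
      intro a _ i hi hai
      subst hai
      simp only [hatt_def, P.cyc_notMem i hi, if_false, P.hidx i hi]
    have hsupp : ∀ e : Sym2 (Fin n), ¬ e.IsDiag → w e ≠ 0 →
        (∃ i, i < L ∧ e = cycE L cyc i) ∨ (∃ a ∈ A, e = s(cyc (att a), a)) := by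
      intro e hd hne
      induction e using Sym2.ind with
      | h x y =>
        have hxy : x ≠ y := fun h => hd (Sym2.mk_isDiag_iff.2 h)
        rcases P.supp x y hxy hne with h | ⟨hx, h⟩ | ⟨hy, h⟩
        · exact Or.inl h
        · right
          obtain ⟨i, hi, hpi⟩ := hparcyc x hx
          refine ⟨x, hTA x hx, ?_⟩
          have : cyc (att x) = par x := by simp only [hatt_def, hx, if_true, hpi, P.hidx i hi]
          rw [this, ← h, Sym2.eq_swap]
        · right
          obtain ⟨i, hi, hpi⟩ := hparcyc y hy
          refine ⟨y, hTA y hy, ?_⟩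
          have : cyc (att y) = par y := by simp only [hatt_def, hy, if_true, hpi, P.hidx i hi]
          rw [this, ← h]
    exact HairyCycle.farRelayRow_ring_of_sunFAR_att P.hL P.hcyc A hK att hatt hcycrel hS w hsupp t hEN hcut

/-- **FAR at layer one on every pendant forest on a cycle (observer on the cycle, possibly itself a relay), GIVEN `SunFAR K 1` for every `K ≥ 2`**
— the unpacked form: `2 < Σ_{a∈A} P(c_0 ↔ a)` and `P(c_0 ↮ a) ≤ t` on `A` imply `P(#{a ∈ A : c_0 ↔ a} ≤ 1) ≤ t`. [this work] -/
theorem layerOne_of_pforest_of_sunFAR (hS : ∀ K, 2 ≤ K → SunFAR K 1) {T : Finset (Fin n)} {par : Fin n → Fin n} {dep : Fin n → ℕ}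
    {w : Sym2 (Fin n) → unitInterval} (P : PForest L cyc idx T par dep w) (A : Finset (Fin n))
    (hA : ∀ a ∈ A, a ∈ T ∨ ∃ i, i < L ∧ a = cyc i) (t : ℝ)
    (hEN : (2 : ℝ) < ∑ a ∈ A, (prodBernoulli w).real (openConn (cyc 0) a))
    (hcut : ∀ a ∈ A, (prodBernoulli w).real (openConn (cyc 0) a : Set (BondConfig (Fin n)))ᶜ ≤ t) :
    (prodBernoulli w).real {ω : BondConfig (Fin n) | (A.filter fun a => ω ∈ openConn (cyc 0) a).card ≤ 1} ≤ t := by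
  by_cases hoA : cyc 0 ∈ A
  · exact layerOne_of_observer_mem w A hoA t hEN hcut
  have hK : 2 ≤ A.card := by
    have hle : ∑ a ∈ A, (prodBernoulli w).real (openConn (cyc 0) a) ≤ ∑ _a ∈ A, (1 : ℝ) :=
      sum_le_sum fun a _ => measureReal_le_one
    rw [sum_const, nsmul_eq_mul, mul_one] at hle
    have : (2 : ℝ) < A.card := by linarith
    exact_mod_cast this.le
  exact farp_one_of_pforest A (hS _ hK) _ T par dep w P le_rfl hA hoA (by push_cast; linarith) t hcut

end Main

end Bundle

end Quant

end Summit.CriticalPhenomena.PercolationContinuityZ3.Theorems
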